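import Mathlib
import HarnessLib
import HarnessLib.Audit
import Summits.AtomisticToContinuum.Statement
import Literature.MathematicalPhysics.StatisticalMechanics.LennardJonesClusters
import Literature.MathematicalPhysics.StatisticalMechanics.RootEnergy
import Literature.Probability.Process.PointStationaryLaw
import Summits.AtomisticToContinuum.Crystallization.Theorems.PalmUnimodularRigidityChargedPatternCrystallizes
import Summits.AtomisticToContinuum.Crystallization.Theorems.PalmUnimodularRigidityBenjaminiSchrammLimit
import Summits.AtomisticToContinuum.Crystallization.Theorems.PricedLinkCensusChargedPeriodicIsOptimal
import HarnessLib.Audit.Status.Attr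

/-!
Route: IsometryAtoms

DORMANT since 2026-08-26T00:45:21Z (reconciler: no traction for 8.2 d (last activity item-evidence-added at 2026-08-17T19:20:05Z); parked, not closed — `ledger route dormant route-AtomisticToContinuum-IsometryAtoms --off` to reactivate) — unstaffed, not closed; items shared with open routes are served there. `ledger route dormant <id> --off` reactivates.

# Route IsometryAtoms — an atom modulo isometry is a crystal — minimising LJ Palm laws are pure and
cohesive; mass transport and Bieberbach do the rest

RESCUER ROUTE (lens = rescuer, cycle 2): the Local-Theorem / multiregular programme
(Delone–Dolbilin–Shtogrin–Galiulin; DolbilinLagariasSenechal1998) and Radin's "global order from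
local sources" (Radin1991) stall on EXACTNESS at every site and on isometry-DIFFUSE ground-state
laws (aperiodic tile sets); the repaired version moves Bieberbach from local cluster counts to the
Palm side, where mass transport supplies the finiteness for free. It suffices to show X = X₁ ∧ X₂
over the frame of the shared crux PeriodicSupport (stmt-12747): for every hard core δ > 0 and every
probability law P on rooted configurations of ℝ³ that is a.s. `IsRootedHardCore δ`,
`IsPointStationaryLaw` (Mecke / mass-transport identity) and MINIMISING (E_P[rootEnergy V_LJ] ≤ e*
:= ⨅ over periodic Q of e(Q)): X₁ = MinimisingLawsHaveAtoms (PURITY): P charges with positive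
probability the EXACT rooted isometry class of ONE configuration Y ⊂ ℝ³ — an atom modulo E(3),
structure unnamed; X₂ = MinimisingLawsCohesive (COHESION): P-a.s. the configuration is relatively
dense (no films, rods, sponges). The soft bridge AtomicLawChargesCrystal (support, new, provable):
an atom carried by a point-stationary law of Delone hard-core configurations has a symmetry group
with finitely many orbits (Mecke balance m(a)·n_ab(r) = m(b)·n_ba(r) between root classes + cubic
growth of a Delone set against the uniform polynomial growth of the orbits of ONE discrete Γ ⊂
E(3)), hence Γ is crystallographic (Bieberbach I) and Y = Q.points for a PeriodicConfiguration Q, so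
P charges every (R, ε)-window of Q: the conclusion of PeriodicSupport. The shared back end of route
BenjaminiSchrammPeriodicSupport (the glue 12748, inlined here as the item PeriodicSupportToHinge,
plus the PROVED tree theorems of the shared items BenjaminiSchrammLimit 9230, CrysEnergyLimit 0626,
ChargedPeriodicIsOptimal 2913 and ChargedPatternCrystallizes 2916, which `closes` invokes directly)
turns it into both conjuncts. No target item is filed: X is the pair of cruxes ranked 2 and 3.
Lean: `MinimisingLawsHaveAtoms ∧ MinimisingLawsCohesive`

## Assembly
Pure logic, sorry-free (lean check rc 0, 0 sorries; axioms propext / Classical.choice / Quot.sound):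
`closes` takes exactly the four open items — the two cruxes, the bridge AtomicLawChargesCrystal and
the glue PeriodicSupportToHinge. The conclusion of PeriodicSupport is obtained pointwise in (δ, P)
by feeding MinimisingLawsCohesive and MinimisingLawsHaveAtoms to AtomicLawChargesCrystal;
PeriodicSupportToHinge applied to it and to the tree theorems benjaminiSchrammLimit_proof (item
9230) and ChargedEnergyGapNegative.crysEnergyLimit (item 0626) gives the hinge (the statement of
GroundStatesChargePeriodic 2911); then exactly the closing of route BenjaminiSchrammPeriodicSupport:
chargedPatternCrystallizes_proof (item 2916) with LennardJonesMinimalDistance_holds gives conjunct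
(ii); a ground-state sequence (LennardJonesGroundStatesExist_holds) is charged by one Q,
chargedPeriodicIsOptimal_proof (item 2913, proved 2026-08-16) makes e(Q) least, and IsLeast.csInf_eq
rewrites ⨅ = e(Q) in crysEnergyLimit for conjunct (i). Rev 4 (route-repair, cone audit): the local
duplicates of the proved shared items 9230 / 0626 / 2913 were dropped from the item list (they were
provable-now by `exact` and only attracted seats), and the two wrapper imports
Theorems.ExcessDecayLiouvilleCrysEnergyLimit /
Theorems.BenjaminiSchrammPeriodicSupportBenjaminiSchrammLimit were replaced by their source modules
(ChargedEnergyGap.Negative.Unconditional via Theorems.PricedLinkCensusChargedPeriodicIsOptimal, and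
Theorems.PalmUnimodularRigidityBenjaminiSchrammLimit), which removes the Theses files of
ExcessDecayLiouville and BenjaminiSchrammPeriodicSupport and the Barlow/Hägg stacking modules from
this route's import cone.

Rationale: WHY THIS LINE. Mechanism: replace IDENTIFICATION of the crystal (charge windows of a named periodic
Q, classify minimising laws, select the stacking) by PURITY — the zero-temperature law is not
isometry-diffuse — and let the Mecke / mass-transport identity (HevelingLast2005; LastPenrose2017
Thm 9.6, (9.16)–(9.19); AldousLyons2007 §2) convert one atom into finitely many symmetry orbits of a
Delone set, i.e. a multiregular point system (DolbilinLagariasSenechal1998), which Bieberbach's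
first theorem (GrahamGrotschelLovasz1996 ch. 19 Thm 5.1; Wolf2011 §3.2) makes lattice-periodic with
the lattice never named. Imported areas: Palm theory / unimodular random networks (probability),
crystallographic groups (discrete geometry), and the Cantor–Bendixson picture of tiling spaces
(BallierDurandJeandel2008 §3.2 Thm 3 and Remark 2, arXiv p. 7: countable = ranked tiling spaces have
periodic minimal elements; strictly quasiperiodic tilings need uncountably many tilings)
transplanted from ℤ² subshifts to E(3)-hulls of hard-core configurations. What it does that prior
routes do not: HolmgrenBoyleLind needs exact finite local complexity of a charged limit plus an open
half-space unique continuation; BenjaminiSchrammPeriodicSupport / PalmUnimodularRigidity must name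
and charge one periodic Q (local close packing a.s. + stacking selection in density form); the
local-theorem cards need congruent ρ-clusters at every site — here the periodicity engine consumes
only an ATOM and COHESION, tolerates every zero-density defect (invisible to a stationary law) and
every continuous family of non-charged configurations, and names no structure, no tolerance and no
stacking. The graph analogue of the bridge is false (the canopy tree carries a unimodular random
root with infinitely many orbits, Lyons–Peres ch. 8 notes); the Euclidean hard-core geometry
(uniform polynomial growth of one discrete motion group) is what makes it true, which is why the
Delone clause X₂ is load-bearing (a single triangular layer carries a point-stationary law).

RANKED CRUXES. #2 MinimisingLawsHaveAtoms (crux) — PURITY. For every δ > 0 and every probability law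
P on `Measure (EuclideanSpace ℝ (Fin 3))` that is P-a.s. `IsRootedHardCore δ`,
`IsPointStationaryLaw` and minimising (∫ rootEnergy V_LJ dP ≤ ⨅_Q e(Q)), there is ONE set Y ⊂ ℝ³
such that the event "μ = count restricted to A(Y − q) for some linear isometry A and some q ∈ Y"
(the rooted isometry class of Y) has positive P-measure — the law has an atom modulo E(3). Y is not
assumed periodic, Delone, or anything. [difficulty: open-problem] (why it might fail: A diffuse
minimising law refutes it: an amorphous/polytetrahedral minimising Palm law, a Sturmian-stacked
Barlow law if the Hägg chain of V_LJ is not locked (|J₂| ≈ 7e-5 vs tail, uncertified), or any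
continuous zero-cost modulation (phason) of the minimiser.) [Radin1991, AizenmanLieb1981,
BallierDurandJeandel2008, arXiv:2009.02586, BlancLewin2015, AldousLyons2007]
#3 MinimisingLawsCohesive (crux) — COHESION. Under the same frame (δ-hard-core a.s.,
point-stationary, minimising), P-a.s. the configuration μ is relatively dense: there is R₀ with
every point of ℝ³ within R₀ of a point of μ — minimising laws charge no films, rods, half-crystals
or sponges. [difficulty: XL] (why it might fail: Cohesion of LJ ground states is unproved
(BlancLewin2015 §2.2): the one-centre frustration slack (site energies below e* are possible) could
fund internal surface of positive density, i.e. a porous minimising law; a slab law with Palm energy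
exactly e* would also refute it.) [BlancLewin2015, Theil2006, HeitmannRadin1980,
Literature.Barriers.AtomisticToContinuum.IcosahedralClusters]
#4 AtomicLawChargesCrystal (crux; intended rank 4 — re-kinded from support at rev 1 because the
deciding theorem consumes it unproved, D-0027 crux-only rule; it is the route's NEW load-bearing
lever and refuter scrutiny is wanted) — THE BRIDGE (believed provable; new in tree and in print). A
probability law P on rooted configurations of ℝ³, a.s. δ-hard-core, point-stationary, a.s.
relatively dense, with an atom modulo isometry at Y, charges every window of ONE periodic
configuration: there is Q : PeriodicConfiguration 3 (in fact Q.points = Y) such that for all R, ε >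
0 the PeriodicSupport matching event has positive P-measure. Proof: on the atom, μ ≅ Y, so Y is
δ-separated and Delone; Sym(Y) ⊂ E(3) is discrete with point stabilisers of bounded order; the Mecke
identity tested on g = 1{root class a, point class b, ‖y‖ ≤ r} gives m(a)·n_ab(r) = m(b)·n_ba(r) for
the class masses m on Y/Sym(Y); summing over b and comparing the cubic growth of Y ∩ B_r with the
uniform growth of Sym(Y)-orbits forces Y/Sym(Y) finite, so Sym(Y) acts cocompactly on ℝ³ and
contains a rank-3 lattice L (Bieberbach I); Y = F + L with finite motif; rooted copies A(Y − q) are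
exactly matched. No energy is used. [difficulty: L] [HevelingLast2005, LastPenrose2017,
AldousLyons2007, DolbilinLagariasSenechal1998, GrahamGrotschelLovasz1996, Wolf2011]
#5 PeriodicSupportToHinge (crux; intended rank 5, lowest staffing — re-kinded only because `closes`
consumes it unproved; content = shared support 12748 of route BenjaminiSchrammPeriodicSupport, still
open there; mathematically identical, a proof of either transfers to the other after unfolding the
inlined antecedents) — GLUE TO THE HINGE (the shared item SupportToHinge
stmt-AtomisticToContinuum-12748 with its three named antecedents/consequent INLINED, so that this
file is order-independent; mathematically identical): [conclusion of PeriodicSupport for every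
minimising point-stationary hard-core law] → [the Benjamini–Schramm limit statement 9230, folded
through the landed definitions] → [CrysEnergyLimit] → [the hinge GroundStatesChargePeriodic
stmt-2911: every LJ ground-state sequence charges ONE periodic Q with positive density at every
scale, frequently in N]. Proof = the portmanteau / density-transfer bookkeeping of 12748 (pick T :=
the matching event at (R+1, ε/2), ρ := P(T)/2, transfer clause, triangle inequality); closes with
12748 by `exact`. [difficulty: M] [AldousLyons2007, AldousSteele2004,
stmt-AtomisticToContinuum-12748, stmt-AtomisticToContinuum-2911]
Proved inputs of the assembly (tree theorems, not items; invoked by `closes` directly):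
BenjaminiSchrammLimit 9230 = benjaminiSchrammLimit_proof
(Theorems.PalmUnimodularRigidityBenjaminiSchrammLimit); CrysEnergyLimit 0626 =
ChargedEnergyGapNegative.crysEnergyLimit (Theorems.ChargedEnergyGap.Negative.Unconditional);
ChargedPeriodicIsOptimal 2913 = chargedPeriodicIsOptimal_proof
(Theorems.PricedLinkCensusChargedPeriodicIsOptimal, closed proved 2026-08-16 — the
surgery-attainment item this route had re-filed as a rank-6 crux); ChargedPatternCrystallizes 2916 =
chargedPatternCrystallizes_proof. Their byte-identical local duplicates (stmt-15780 / 15781 / 15782)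
were dropped at rev 4 (route-repair): nothing open in this route is provable-now, and the four
remaining items are exactly the hypotheses of `closes`.

TWO-LAYER PLAN. Foreseen, NOT filed: MinimisingLawsHaveAtoms ⇐ PatchAtomsEverywhere (for every
radius R the R-patch of the root, modulo isometry, has an atom of P-mass bounded below uniformly in
R — local purity, where phonon/Korn rigidity of close-packed environments and exactness of
minimising laws live) → NoPhason (a minimising ergodic law whose finite patches are atomic but whose
global class is diffuse carries a zero-cost continuous or combinatorial modulus; for LJ the only
candidate modulus is the Hägg word, excluded by the locked stacking phase — shared territory with
MinMeanCycleStackingLock / PoissonBesselStacking registry items, to be WANTED here rather than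
re-filed) → MinimisingLawsHaveAtoms (k = 2, depth 1). MinimisingLawsCohesive ⇐ NoFoam-type finite-N
statement (item 2912 of the BS family) → portmanteau transfer (k = 2). Split only when a prover
releases a crux with a census or PeriodicSupportToHinge closes (2913 is proved).

KILL CRITERIA. A diffuse minimising point-stationary hard-core law for V_LJ (equivalently a
continuously or combinatorially degenerate infinite-volume ground state: amorphous,
quasicrystalline, or aperiodically stacked with energy density e*) refutes MinimisingLawsHaveAtoms
and closes the route (close --reason refuted:MinimisingLawsHaveAtoms); a certified proof that the LJ
Hägg chain is NOT locked (|J₂| below the tail sum) forces the same. A minimising slab / porous law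
refutes MinimisingLawsCohesive → pivot: restrict the frame to local-limit laws of ground states
(9230 format) and re-derive. If GroundStatesChargePeriodic (2911) or PeriodicSupport (12747) is
proved elsewhere the route is mooted (its back end fires directly) — close superseded.

NOT DECOMPOSED YET. The LJ-specific physics inside PURITY (local close packing of minimising laws
a.s.; the locked stacking phase in measure form) is deliberately not split at open: those are the
shared XL territories of PalmUnimodularRigidity.MinimiserShells / LayeredLawsSelectHcp and of the
stacking routes, to be attached as wanted items once a prover asks; the bridge's ingredients (Palm
inversion with finite intensity, bounded stabiliser orders, Bieberbach I for E(3), motif extraction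
F + L) are lemmas inside AtomicLawChargesCrystal's proof file, not items.

CHEAPEST FALSIFIER. (1) The bridge without the Delone clause is FALSE: the deterministic rooted
triangular layer ℤ²-lattice × {0} ⊂ ℝ³ is point-stationary (IsPointStationaryLaw.of_ae_invariant),
1-hard-core, an atom, and matches no PeriodicConfiguration 3 two-way — hence cohesion is filed as
its own crux (checked by hand; the layer law is not minimising: its Palm energy misses half the
neighbours). (2) Finite clusters with uniform root are point-stationary atoms: excluded from the
frame because E(N)/N > e* strictly (periodisation with attractive cross terms; CrysEnergyLimit). (3)
The one-point law δ_(δ₀) (tree witness isPointStationaryLaw_dirac_dirac_zero) has rootEnergy 0 > e*: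
excluded. (4) Graph analogue of the bridge is false (canopy tree) — the Euclidean growth argument
was re-derived by hand for discrete Γ ⊂ E(3) of translation rank k < 3 (orbits in bounded
neighbourhoods of k-flats, Y/Γ finite ⇒ Y not Delone). No kit job needed; nothing killed the line.

NUMBERS. e* ≈ −0.7175 per particle (Blanc–Lewin units, relaxed close packing a* ≈ 0.9712; tree
census of DefectFreeCrystallizes); Hägg couplings |J₂| ≈ 7.25e-5, |J₃| ≈ 8.5e-8 (uncertified floats,
stacking routes' evidence) — the margin on which purity of the stacking degree of freedom rests; LJ
minimal distance δ = 1/3 usable (LennardJonesMinimalDistance_holds).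

DEFINITION REQUESTS. None: IsPointStationaryLaw, IsRootedHardCore, rootEnergy, PeriodicConfiguration
are landed; Bieberbach's first theorem for E(3) will be vendored by the prover of
AtomicLawChargesCrystal as a Literature fact (GrahamGrotschelLovasz1996 ch. 19 Thm 5.1; Wolf2011
§3.2) if not proved outright.

Novelty: Searches (2026-08-16): grep of all 107 idea cards (open + _closed) and 74 Theses of the sub for
cantor|bendixson|baire|countabl|bieberbach|scattered (Bieberbach only via local cluster criteria:
fixed-radius-local-theorem-bieberbach, multiregular-bounded-counting,
local-theorem-vertex-homogeneity; countability only in HolmgrenBoyleLind's why-fail); lit search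
--hybrid "stationary point process concentrated on rigid motions of a single configuration periodic"
(12 hits, Last–Penrose ch. 9 the only relevant), "unimodular random rooted graph concentrated on a
single deterministic graph quasi-transitive mass transport" (10 hits; Lyons–Peres ch. 8:
quasi-transitive ⇒ unimodular rooting, converse direction not treated; canopy counterexample),
"Bieberbach discrete subgroup Euclidean motions crystallographic" (books; Lagarias Handbook ch. 19
p. 939), "Hsiang Kepler local density" (history only); lit read arXiv:0802.2828 (BDJ Thm 3 / Remark
2 p. 7), arXiv:1504.01153 §2.3 p. 7, arXiv:1407.0692 p. 7 (Conj. 2.2), arXiv:1907.07923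
(Giuliani–Theil: lattice-based, positive T); lit frontier AtomisticToContinuum --since 2020 (30
rows, none on Palm purity); ledger negatives (15; 2 on this sub, both misstatements, steered around:
every configuration here is a.s. hard-core or a ground state).
Nearest prior art found: DolbilinLagariasSenechal1998 (multiregular systems = finitely many symmetry
orbits ⇒ crystallographic; their criteria are LOCAL cluster counts); BallierDurandJeandel2008
(countable ℤ²  [refs: 0802.2828, 1504.01153, 1407.0692, 1907.07923, DolbilinLagariasSenechal1998, BallierDurandJeandel2008, HevelingLast2005, AldousLyons2007]

Barriers (technique_class: palm-mass-transport, bieberbach-multiregular, purity): - technique_class: palm-mass-transport, bieberbach-multiregular, purity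
- Literature.Barriers.AtomisticToContinuum.AperiodicTilingGroundStates: does not bite the bridge
(Wang/Berger ground-state laws are isometry-diffuse — no atom — which is exactly what PURITY asserts
fails for V_LJ); it is the declared kill criterion of MinimisingLawsHaveAtoms, and the one-species
radial continuum potential V_LJ is outside the barrier's lattice/finite-alphabet class (scope caveat
of the barrier file).
- Literature.Barriers.AtomisticToContinuum.SutoDegenerateGroundStates: Sütő's Fourier-positive
potentials have continuously deformable minimising laws (diffuse): the bet is that V_LJ, with its
r⁻¹² core and non-integrable, non-positive-type shape, has no zero-cost volume-preserving
deformations; the barrier's hypothesis class (φ̂ ≥ 0, compact support) excludes V_LJ.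
- Literature.Barriers.AtomisticToContinuum.Hubbard1978_mostHomogeneous: Hubbard/Sturmian chains are
the model of a diffuse minimising law through the stacking word; evaded only if the LJ Hägg chain is
locked (|J₂| dominates the tail) — it does not evade it by itself; the bet is the 7e-5 vs 1e-7
margin, shared with every stacking route.
- Literature.Barriers.AtomisticToContinuum.KissingTwelveDegeneracy: respected (and likewise
Literature.Barriers.AtomisticToContinuum.ShortRangeStackingBlindness) — the bridge never reads
shells or stackings; the full infinite-range V_LJ enters only through the minimising hypothesis.
- Literature.Barr

History (route lifecycle, newest last):
- 2026-08-16T17:03:02Z · rev 4: restated Assembly (stmt-AtomisticToContinuum-15783) — route-repair (cone; unit rrepair-AtomisticToContinuum-IsometryA-99fd8e3f): REROUTED onto proved tree theorems — item ChargedPeriodicIsOptimal (stmt-15782, re-fi (planner-rrepair-AtomisticToContinuum-IsometryA-99fd8e3f-0)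
- 2026-08-16T17:03:02Z · rev 4: dropped stmt-AtomisticToContinuum-15780, stmt-AtomisticToContinuum-15781, stmt-AtomisticToContinuum-15782 — route-repair (cone; unit rrepair-AtomisticToContinuum-IsometryA-99fd8e3f): REROUTED onto proved tree theorems — item ChargedPeriodicIsOptimal (stmt-15782, re-fi (planner-rrepair-AtomisticToContinuum-IsometryA-99fd8e3f-0)
- 2026-08-26T00:45:21Z · DORMANT — reconciler: no traction for 8.2 d (last activity item-evidence-added at 2026-08-17T19:20:05Z); parked, not closed — `ledger route dormant route-AtomisticToConti (operator:999:3727399)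

sub-problem: Crystallization · status: dormant · opened planner-plan-lens-AtomisticToContinuum-rescuer-v2-g2-0 2026-08-16T16:42:24Z · rev 4 · ledger route-AtomisticToContinuum-IsometryAtoms
GENERATED by the gate from the ledger (D-0016/17). Provers cite these decls: `theorem foo : Summit.AtomisticToContinuum.Crystallization.Theses.IsometryAtoms.<Decl> := …` in Summits/AtomisticToContinuum/Crystallization/Theorems/<Name>.lean.
-/

namespace Summit.AtomisticToContinuum.Crystallization.Theses.IsometryAtoms

open scoped BigOperators Topology Manifold Classical MeasureTheory ProbabilityTheory Matrix InnerProductSpace ComplexConjugate ContinuousMap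
open Filter Set Function TopologicalSpace MeasureTheory

attribute [summit_statement] _root_.Crystallization

/-- item stmt-AtomisticToContinuum-15776 · crux · rank 2 · open · by planner
why it might fail: A diffuse minimising law refutes it: an amorphous/polytetrahedral minimising Palm law, a Sturmian-stacked Barlow law if the Hägg chain of V_LJ is not locked (|J₂| ≈ 7e-5 vs tail, uncertified), or any continuous zero-cost modulation (phason) of the minimiser.
sources: Radin1991, AizenmanLieb1981, BallierDurandJeandel2008, arXiv:2009.02586, BlancLewin2015, AldousLyons2007
[crux] PURITY. For every δ > 0 and every probability law P on `Measure (EuclideanSpace ℝ (Fin 3))`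
that is P-a.s. `IsRootedHardCore δ`, `IsPointStationaryLaw` and minimising (∫ rootEnergy V_LJ dP ≤
⨅_Q e(Q)), there is ONE set Y ⊂ ℝ³ such that the event "μ = count restricted to A(Y − q) for some
linear isometry A and some q ∈ Y" (the rooted isometry class of Y) has positive P-measure — the law
has an atom modulo E(3). Y is not assumed periodic, Delone, or anything. [difficulty: open-problem] -/
@[route_item "route-AtomisticToContinuum-IsometryAtoms", crux]
def MinimisingLawsHaveAtoms : Prop :=
  ∀ δ : ℝ, 0 < δ → ∀ P : MeasureTheory.Measure (MeasureTheory.Measure (EuclideanSpace ℝ (Fin 3))), MeasureTheory.IsProbabilityMeasure P → (∀ᵐ μ ∂P, Literature.Probability.Process.IsRootedHardCore δ μ) → Literature.Probability.Process.IsPointStationaryLaw P → (∫ μ, Literature.MathematicalPhysics.StatisticalMechanics.rootEnergy Literature.MathematicalPhysics.StatisticalMechanics.lennardJones μ ∂P) ≤ (⨅ Q : Literature.MathematicalPhysics.StatisticalMechanics.PeriodicConfiguration 3, Q.energyPerParticle Literature.MathematicalPhysics.StatisticalMechanics.lennardJones) → ∃ Y : Set (EuclideanSpace ℝ (Fin 3)),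 0 < P {μ | ∃ A : EuclideanSpace ℝ (Fin 3) →ₗᵢ[ℝ] EuclideanSpace ℝ (Fin 3), ∃ q ∈ Y, μ = (MeasureTheory.Measure.count : MeasureTheory.Measure (EuclideanSpace ℝ (Fin 3))).restrict ((fun s => A (s - q)) '' Y)}

/-- item stmt-AtomisticToContinuum-15777 · crux · rank 3 · open · by planner
why it might fail: Cohesion of LJ ground states is unproved (BlancLewin2015 §2.2): the one-centre frustration slack (site energies below e* are possible) could fund internal surface of positive density, i.e. a porous minimising law; a slab law with Palm energy exactly e* would also refute it.
sources: BlancLewin2015, Theil2006, HeitmannRadin1980, Literature.Barriers.AtomisticToContinuum.IcosahedralClusters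
[crux] COHESION. Under the same frame (δ-hard-core a.s., point-stationary, minimising), P-a.s. the
configuration μ is relatively dense: there is R₀ with every point of ℝ³ within R₀ of a point of μ —
minimising laws charge no films, rods, half-crystals or sponges. [difficulty: XL] -/
@[route_item "route-AtomisticToContinuum-IsometryAtoms", crux]
def MinimisingLawsCohesive : Prop :=
  ∀ δ : ℝ, 0 < δ → ∀ P : MeasureTheory.Measure (MeasureTheory.Measure (EuclideanSpace ℝ (Fin 3))), MeasureTheory.IsProbabilityMeasure P → (∀ᵐ μ ∂P, Literature.Probability.Process.IsRootedHardCore δ μ) → Literature.Probability.Process.IsPointStationaryLaw P → (∫ μ, Literature.MathematicalPhysics.StatisticalMechanics.rootEnergy Literature.MathematicalPhysics.StatisticalMechanics.lennardJones μ ∂P) ≤ (⨅ Q : Literature.MathematicalPhysics.StatisticalMechanics.PeriodicConfiguration 3, Q.energyPerParticle Literature.MathematicalPhysics.StatisticalMechanics.lennardJones) → ∀ᵐ μ ∂P, ∃ R₀ : ℝ, ∀ z : EuclideanSpace ℝ (Fin 3), ∃ y : EuclideanSpace ℝ (Fin 3), μ {y} ≠ 0 ∧ dist z y ≤ R₀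

/-- item stmt-AtomisticToContinuum-15778 · crux · rank 9 · closed · proved by Summit.AtomisticToContinuum.Crystallization.Theorems.atomicLawChargesCrystal_proof @ f24f9d069eef (prover) · by planner
why it might fail: Route's own new lemma: fails if the Mecke balance cannot bound class masses (needs bounded point-stabiliser orders in a Delone δ-separated set), if the outer-measure atom cannot be conditioned on, or without the Delone clause (single-layer law); Bieberbach I for E(3) not in Mathlib.
sources: HevelingLast2005, LastPenrose2017, AldousLyons2007, DolbilinLagariasSenechal1998, GrahamGrotschelLovasz1996, Wolf2011
[support] THE BRIDGE (provable; new in tree). A probability law P on rooted configurations of ℝ³,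
a.s. δ-hard-core, point-stationary, a.s. relatively dense, with an atom modulo isometry at Y,
charges every window of ONE periodic configuration: there is Q : PeriodicConfiguration 3 (in fact
Q.points = Y) such that for all R, ε > 0 the PeriodicSupport matching event has positive P-measure.
Proof: on the atom, μ ≅ Y, so Y is δ-separated and Delone; Sym(Y) ⊂ E(3) is discrete with point
stabilisers of bounded order; the Mecke identity tested on g = 1{root class a, point class b, ‖y‖ ≤
r} gives m(a)·n_ab(r) = m(b)·n_ba(r) for the class masses m on Y/Sym(Y); summing over b and
comparing the cubic growth of Y ∩ B_r with the uniform growth of Sym(Y)-orbits forces Y/Sym(Y)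
finite, so Sym(Y) acts cocompactly on ℝ³ and contains a rank-3 lattice L (Bieberbach I); Y = F + L
with finite motif; rooted copies A(Y − q) are exactly matched. No energy is used. [difficulty: L] -/
@[route_item "route-AtomisticToContinuum-IsometryAtoms", crux]
def AtomicLawChargesCrystal : Prop :=
  ∀ δ : ℝ, 0 < δ → ∀ P : MeasureTheory.Measure (MeasureTheory.Measure (EuclideanSpace ℝ (Fin 3))), MeasureTheory.IsProbabilityMeasure P → (∀ᵐ μ ∂P, Literature.Probability.Process.IsRootedHardCore δ μ) → Literature.Probability.Process.IsPointStationaryLaw P → (∀ᵐ μ ∂P, ∃ R₀ : ℝ, ∀ z : EuclideanSpace ℝ (Fin 3), ∃ y : EuclideanSpace ℝ (Fin 3), μ {y} ≠ 0 ∧ dist z y ≤ R₀) → (∃ Y : Set (EuclideanSpace ℝ (Fin 3)), 0 < P {μ | ∃ A : EuclideanSpace ℝ (Fin 3) →ₗᵢ[ℝ] EuclideanSpace ℝ (Fin 3), ∃ q ∈ Y, μ = (MeasureTheory.Measure.count : MeasureTheory.Measure (EuclideanSpace ℝ (Fin 3))).restrict ((fun s => A (s - q)) '' Y)}) → ∃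 Q : Literature.MathematicalPhysics.StatisticalMechanics.PeriodicConfiguration 3, ∀ R ε : ℝ, 0 < R → 0 < ε → 0 < P {μ | ∃ A : EuclideanSpace ℝ (Fin 3) →ₗᵢ[ℝ] EuclideanSpace ℝ (Fin 3), ∃ q ∈ Q.points, (∀ s ∈ Q.points, dist s q ≤ R → ∃ y : EuclideanSpace ℝ (Fin 3), μ {y} ≠ 0 ∧ dist y (A (s - q)) ≤ ε) ∧ (∀ y : EuclideanSpace ℝ (Fin 3), μ {y} ≠ 0 → ‖y‖ ≤ R → ∃ s ∈ Q.points, dist y (A (s - q)) ≤ ε)}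

/-- item stmt-AtomisticToContinuum-15779 · crux · rank 9 · closed · proved by Summit.AtomisticToContinuum.Crystallization.Theorems.periodicSupportToHinge_proof @ 8db2a0c0bb74 (prover) · by planner
why it might fail: Transfer from positive OUTER measure of the matching event to 9230's density clause (ρ < P T as a measure value) needs the event or an inner approximation to be measurable/open in the Giry σ-algebra; a non-measurable T could break the hand-over.
sources: AldousLyons2007, AldousSteele2004, stmt-AtomisticToContinuum-12748
[support] GLUE TO THE HINGE (the shared item SupportToHinge stmt-AtomisticToContinuum-12748 with its
three named antecedents/consequent INLINED, so that this file is order-independent; mathematically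
identical): [conclusion of PeriodicSupport for every minimising point-stationary hard-core law] →
[the Benjamini–Schramm limit statement 9230, folded through the landed definitions] →
[CrysEnergyLimit] → [the hinge GroundStatesChargePeriodic stmt-2911: every LJ ground-state sequence
charges ONE periodic Q with positive density at every scale, frequently in N]. Proof = the
portmanteau / density-transfer bookkeeping of 12748 (pick T := the matching event at (R+1, ε/2), ρ
:= P(T)/2, transfer clause, triangle inequality); closes with 12748 by `exact`. [difficulty: M] -/
@[route_item "route-AtomisticToContinuum-IsometryAtoms", crux]
def PeriodicSupportToHinge : Prop :=
  (∀ δ : ℝ, 0 < δ → ∀ P : MeasureTheory.Measure (MeasureTheory.Measure (EuclideanSpace ℝ (Fin 3))), MeasureTheory.IsProbabilityMeasure P → (∀ᵐ μ ∂P, Literature.Probability.Process.IsRootedHardCore δ μ) → Literature.Probability.Process.IsPointStationaryLaw P → (∫ μ, Literature.MathematicalPhysics.StatisticalMechanics.rootEnergy Literature.MathematicalPhysics.StatisticalMechanics.lennardJones μ ∂P) ≤ (⨅ Q : Literature.MathematicalPhysics.StatisticalMechanics.PeriodicConfiguration 3, Q.energyPerParticle Literature.MathematicalPhysics.StatisticalMechanics.lennardJones)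 → ∃ Q : Literature.MathematicalPhysics.StatisticalMechanics.PeriodicConfiguration 3, ∀ R ε : ℝ, 0 < R → 0 < ε → 0 < P {μ | ∃ A : EuclideanSpace ℝ (Fin 3) →ₗᵢ[ℝ] EuclideanSpace ℝ (Fin 3), ∃ q ∈ Q.points, (∀ s ∈ Q.points, dist s q ≤ R → ∃ y : EuclideanSpace ℝ (Fin 3), μ {y} ≠ 0 ∧ dist y (A (s - q)) ≤ ε) ∧ (∀ y : EuclideanSpace ℝ (Fin 3), μ {y} ≠ 0 → ‖y‖ ≤ R → ∃ s ∈ Q.points, dist y (A (s - q)) ≤ ε)}) → (∀ x : (N : ℕ) → (Fin N → EuclideanSpace ℝ (Fin 3)), (∀ N, Literature.MathematicalPhysics.StatisticalMechanics.IsGroundState Literature.MathematicalPhysics.StatisticalMechanics.lennardJones (x N)) → ∃ φ : ℕ → ℕ, StrictMono φ ∧ ∃ δ : ℝ, 0 < δ ∧ ∃ P : MeasureTheory.Measure (MeasureTheory.Measure (EuclideanSpace ℝ (Fin 3))), MeasureTheory.IsProbabilityMeasure P ∧ (∀ᵐ μ ∂P, Literature.Probability.Process.IsRootedHardCore δ μ)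 ∧ Literature.Probability.Process.IsPointStationaryLaw P ∧ Filter.Tendsto (fun j : ℕ => Literature.MathematicalPhysics.StatisticalMechanics.groundStateEnergy Literature.MathematicalPhysics.StatisticalMechanics.lennardJones 3 (φ j) / (φ j : ℝ)) Filter.atTop (nhds (∫ μ, Literature.MathematicalPhysics.StatisticalMechanics.rootEnergy Literature.MathematicalPhysics.StatisticalMechanics.lennardJones μ ∂P)) ∧ ∀ T : Set (MeasureTheory.Measure (EuclideanSpace ℝ (Fin 3))), ∀ R ε : ℝ, 0 < ε → ∀ ρ : ℝ, ρ < (P T).toReal → ∀ᶠ j : ℕ in Filter.atTop, ρ * (φ j : ℝ) ≤ (Nat.card {i : Fin (φ j) // ∃ ν ∈ T, ((∀ p : EuclideanSpace ℝ (Fin 3), ν {p} ≠ 0 → ‖p‖ ≤ R → ∃ q ∈ (Set.range (fun k : Fin (φ j) => x (φ j) k - x (φ j) i)), dist q p ≤ ε) ∧ (∀ q ∈ (Set.range (fun k : Fin (φ j) => x (φ j) k - x (φ j) i)), ‖q‖ ≤ R → ∃ p : EuclideanSpace ℝ (Fin 3), ν {p} ≠ 0 ∧ dist q p ≤ ε))}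 : ℝ)) → (Filter.Tendsto (fun N : ℕ => Literature.MathematicalPhysics.StatisticalMechanics.groundStateEnergy Literature.MathematicalPhysics.StatisticalMechanics.lennardJones 3 N / N) Filter.atTop (nhds (⨅ Q : Literature.MathematicalPhysics.StatisticalMechanics.PeriodicConfiguration 3, Q.energyPerParticle Literature.MathematicalPhysics.StatisticalMechanics.lennardJones))) → (∀ x : (N : ℕ) → (Fin N → EuclideanSpace ℝ (Fin 3)), (∀ N, Literature.MathematicalPhysics.StatisticalMechanics.IsGroundState Literature.MathematicalPhysics.StatisticalMechanics.lennardJones (x N)) → ∃ Q : Literature.MathematicalPhysics.StatisticalMechanics.PeriodicConfiguration 3, ∀ R ε : ℝ, 0 < R → 0 < ε → ∃ ρ : ℝ, 0 < ρ ∧ ∃ᶠ N : ℕ in Filter.atTop, ρ * (N : ℝ) ≤ (Nat.card {i : Fin N // ∃ A : EuclideanSpace ℝ (Fin 3) →ₗᵢ[ℝ] EuclideanSpace ℝ (Fin 3), ∃ q ∈ Q.points, (∀ s ∈ Q.points, dist s q ≤ R → ∃ j : Fin N, dist (x N j) (x N i + A (s - q)) ≤ ε) ∧ (∀ j : Fin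 N, dist (x N j) (x N i) ≤ R → ∃ s ∈ Q.points, dist (x N j) (x N i + A (s - q)) ≤ ε)} : ℝ))

-- earlier Assembly (stmt-AtomisticToContinuum-15783, replaced 2026-08-16T17:03:02Z -> stmt-AtomisticToContinuum-16004): retired by None — MinimisingLawsHaveAtoms → MinimisingLawsCohesive → AtomicLawChargesCrystal → PeriodicSupportToHinge → BenjaminiSchrammLimit → CrysEnergyLimit → ChargedPeriodicIsOptimal → _root_.Crystallization
/-- item stmt-AtomisticToContinuum-16004 · assembly · rank 1 · open · by planner
sources: BlancLewin2015, AldousLyons2007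
[assembly] MinimisingLawsHaveAtoms → MinimisingLawsCohesive → AtomicLawChargesCrystal →
PeriodicSupportToHinge → Crystallization (the proved shared items 9230 / 0626 / 2913 / 2916 enter
`closes` as tree theorems; `assembly_holds := closes`). -/
@[route_item "route-AtomisticToContinuum-IsometryAtoms"]
def Assembly : Prop :=
  MinimisingLawsHaveAtoms → MinimisingLawsCohesive → AtomicLawChargesCrystal → PeriodicSupportToHinge → _root_.Crystallization

/-! D-0027 §2.1 — DECIDING THEOREM (planner-authored via `route open/edit --closes-file`; by planner-rrepair-AtomisticToContinuum-IsometryA-99fd8e3f-0 2026-08-16T17:03:02Z):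
its hypotheses are this route's items and its conclusion the sub-problem Statement (glue_lint), and it elaborates with this file. -/

@[closes "route-AtomisticToContinuum-IsometryAtoms"] theorem closes : MinimisingLawsHaveAtoms → MinimisingLawsCohesive → AtomicLawChargesCrystal →
    PeriodicSupportToHinge → _root_.Crystallization := by
  intro hAtom hCoh hG hStoH
  -- purity + cohesion + the bridge give the conclusion of `PeriodicSupport` for every minimising
  -- law; the Benjamini–Schramm limit (item 9230) and `E(N)/N → ⨅ e` (item 0626) are tree theorems
  have hGCP := hStoH (fun δ hδ P hP hhc hst hE =>
      hG δ hδ P hP hhc hst (hCoh δ hδ P hP hhc hst hE) (hAtom δ hδ P hP hhc hst hE))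
    Summit.AtomisticToContinuum.Crystallization.Theorems.benjaminiSchrammLimit_proof
    Summit.AtomisticToContinuum.Crystallization.Theorems.ChargedEnergyGapNegative.crysEnergyLimit
  show Literature.MathematicalPhysics.StatisticalMechanics.HasPeriodicGroundStateEnergy
      Literature.MathematicalPhysics.StatisticalMechanics.lennardJones 3 ∧
    Literature.MathematicalPhysics.StatisticalMechanics.IsCrystallizing
      Literature.MathematicalPhysics.StatisticalMechanics.lennardJones 3
  refine ⟨?_, Summit.AtomisticToContinuum.Crystallization.Theorems.chargedPatternCrystallizes_proof
    hGCP Literature.MathematicalPhysics.StatisticalMechanics.LennardJonesMinimalDistance_holds⟩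
  choose x hx using
    (show ∀ N : ℕ, ∃ y : Fin N → EuclideanSpace ℝ (Fin 3),
        Literature.MathematicalPhysics.StatisticalMechanics.IsGroundState
          Literature.MathematicalPhysics.StatisticalMechanics.lennardJones y from
      Literature.MathematicalPhysics.StatisticalMechanics.LennardJonesGroundStatesExist_holds)
  obtain ⟨Q, hQ⟩ := hGCP x hx
  -- item 2913 `ChargedPeriodicIsOptimal` is a tree theorem (`chargedPeriodicIsOptimal_proof`)
  have hleast :=
    Summit.AtomisticToContinuum.Crystallization.Theorems.chargedPeriodicIsOptimal_proof Q ⟨x, hx, hQ⟩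
  refine ⟨Q, hleast, ?_⟩
  have h1 : (⨅ Q' : Literature.MathematicalPhysics.StatisticalMechanics.PeriodicConfiguration 3,
      Q'.energyPerParticle Literature.MathematicalPhysics.StatisticalMechanics.lennardJones) =
      Q.energyPerParticle Literature.MathematicalPhysics.StatisticalMechanics.lennardJones :=
    hleast.csInf_eq
  rw [← h1]
  exact Summit.AtomisticToContinuum.Crystallization.Theorems.ChargedEnergyGapNegative.crysEnergyLimit

end Summit.AtomisticToContinuum.Crystallization.Theses.IsometryAtoms
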